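import Mathlib
import Literature.Probability.RandomPlanarGeometry.ChordalRestrictionMarkov
import Literature.Probability.RandomPlanarGeometry.CurveClassStopAtMeasurable
import Summits.CriticalPhenomena.SAWScalingLimit.Theorems.SAWRestrictionRigidityAxiomsOfLimitKernelClauseRangeSplit
import Summits.CriticalPhenomena.SAWScalingLimit.Theorems.SAWRestrictionRigidityAxiomsOfLimitKernelClauseMarkovLintegral
import Summits.CriticalPhenomena.SAWScalingLimit.Theorems.SAWRestrictionRigidityAxiomsOfLimitKernelClauseRestrictionLintegral
import HarnessLib

/-!
# Relative restriction: the Markov kernels of nested Dobrushin domains are compatible a.e.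

Crux `AxiomsOfLimit` (stmt-CriticalPhenomena-1370), line `registered`, stub
`stub_relativeRestrictionAE` (lead c5). Theorems only.

Let `P` be a chordal family with the two-sided restriction property (i) and let `Q` be a
domain-Markov extension of `P` with measurable kernels. For nested Dobrushin domains `E ⊆ D` with
the same marked points, a closed set `F` and a Borel `T`, writing `R = {γ ⊆ closure E}`:
for `P D`-a.e. `γ`, if the past `γ.stopAt F` stays in `closure E` then
`Q E (γ.stopAt F) T · Q D (γ.stopAt F) R = Q D (γ.stopAt F) (T ∩ R)`, i.e. the Markov kernel of
the sub-domain `E` is the Markov kernel of `D` conditioned on the future staying in `closure E`.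

Proof, from three landed bricks of the same line: (A) restriction in functional form
`(∫ h dP E) · P D R = ∫_R h dP D` (`stub_restriction_lintegral`); (B) Markov in functional form
`∫_{startFrom F ∈ T'} h (stopAt F) dP D = ∫ h (stopAt F) · Q D (stopAt F) T' dP D`
(`stub_markov_lintegral`); (C) a curve stays in `K` iff both its past and its future at `F` stay
in `K` (`stub_rangeSubset_iff_stopAt_startFrom`). (D) For Borel `S`, both
`∫_{stopAt F ∈ S ∩ R} Q E (stopAt F) T · Q D (stopAt F) R dP D` and
`∫_{stopAt F ∈ S ∩ R} Q D (stopAt F) (T ∩ R) dP D` equal `P E (stopAt F ∈ S, startFrom F ∈ T) · P D R`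
(Markov at `E`, (A), (C), (B); resp. (i), (C), Markov at `D`), so the two integrands agree
`P D`-a.e. on `{stopAt F ∈ R}` (a.e. uniqueness of densities on the image measure of the pasts).

References: G. F. Lawler, O. Schramm, W. Werner, *Conformal restriction: the chordal case* (2003)
§1, §3; W. Werner, *Lectures on two-dimensional critical percolation* (2007) §3.2 (2).
All [folklore].
-/

noncomputable section

open MeasureTheory Set Filter
open scoped ENNReal

namespace Summit.CriticalPhenomena.SAWScalingLimit.Theorems.AxiomsOfLimitKernelClause

open Literature.Probability.RandomPlanarGeometry

/-! ### The relative restriction identity, almost everywhere -/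

/-- **Relative restriction, a.e.** Let `P` be chordal with the two-sided restriction property,
`Q` a Markov extension of `P` with measurable kernels, `E ⊆ D` nested Dobrushin domains with the
same marked points, `F` closed and `T` Borel; write `R = {⊆ closure E}`. Then for `P D`-a.e. `γ`,
if `γ.stopAt F ∈ R` then `Q E (γ.stopAt F) T · Q D (γ.stopAt F) R = Q D (γ.stopAt F) (T ∩ R)`.
For every Borel `S` both `∫_{stopAt F ∈ S ∩ R} Q E (·) T · Q D (·) R dP D` and
`∫_{stopAt F ∈ S ∩ R} Q D (·) (T ∩ R) dP D` equal `P E (stopAt F ∈ S, startFrom F ∈ T) · P D R`,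
whence the integrands agree a.e. on `{stopAt F ∈ R}`. [folklore] -/
theorem RelRes.relativeRestriction_ae {P : ChordalFamily} (hch : P.IsChordal)
    (hR : P.IsRestriction) {Q : DobrushinDomain → CurveClass ℂ → Measure (CurveClass ℂ)}
    (hQ : P.IsMarkovExtension Q)
    (hQm : ∀ (D : DobrushinDomain) (T : Set (CurveClass ℂ)), MeasurableSet T →
      Measurable fun p : CurveClass ℂ => Q D p T)
    {D E : DobrushinDomain} (hsub : E.carrier ⊆ D.carrier) (h0 : E.pt 0 = D.pt 0)
    (h1 : E.pt 1 = D.pt 1) {F : Set ℂ} (hF : IsClosed F) {T : Set (CurveClass ℂ)}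
    (hT : MeasurableSet T) :
    ∀ᵐ γ ∂P D, γ.stopAt F ∈ CurveClass.rangeSubset (closure E.carrier) →
      Q E (γ.stopAt F) T * Q D (γ.stopAt F) (CurveClass.rangeSubset (closure E.carrier)) =
        Q D (γ.stopAt F) (T ∩ CurveClass.rangeSubset (closure E.carrier)) := by
  set R := CurveClass.rangeSubset (closure E.carrier)
  have hRm : MeasurableSet R := CurveClass.measurableSet_rangeSubset isClosed_closure
  have hg : Measurable (CurveClass.stopAt F : CurveClass ℂ → CurveClass ℂ) :=
    CurveClass.measurable_stopAt hF
  have hf : Measurable (CurveClass.startFrom F : CurveClass ℂ → CurveClass ℂ) :=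
    CurveClass.measurable_startFrom hF
  haveI : IsProbabilityMeasure (P D) := (hch D).1
  -- (C): staying in `closure E` splits along (past, future)
  have hsplit : ∀ c : CurveClass ℂ, c ∈ R ↔ c.stopAt F ∈ R ∧ c.startFrom F ∈ R := fun c =>
    stub_rangeSubset_iff_stopAt_startFrom F (closure E.carrier) c
  -- the kernel value of the sub-domain
  have hk : Measurable fun p : CurveClass ℂ => Q E p T := hQm E T hT
  -- the identity integrated against every Borel set of pasts
  have key : ∀ S : Set (CurveClass ℂ), MeasurableSet S →
      ∫⁻ γ in CurveClass.stopAt F ⁻¹' (S ∩ R), Q E (γ.stopAt F) T * Q D (γ.stopAt F) R ∂P D =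
        ∫⁻ γ in CurveClass.stopAt F ⁻¹' (S ∩ R), Q D (γ.stopAt F) (T ∩ R) ∂P D := by
    intro S hS
    have hSR : MeasurableSet (S ∩ R) := hS.inter hRm
    -- the `D`-side: restriction (i), (C), Markov at `D`
    have hDside : P E (CurveClass.stopAt F ⁻¹' S ∩ CurveClass.startFrom F ⁻¹' T) * P D R =
        ∫⁻ γ in CurveClass.stopAt F ⁻¹' (S ∩ R), Q D (γ.stopAt F) (T ∩ R) ∂P D := by
      rw [hR D E hsub h0 h1 _ ((hS.preimage hg).inter (hT.preimage hf))]
      have hset : CurveClass.stopAt F ⁻¹' S ∩ CurveClass.startFrom F ⁻¹' T ∩ R =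
          CurveClass.stopAt F ⁻¹' (S ∩ R) ∩ CurveClass.startFrom F ⁻¹' (T ∩ R) := by
        ext c
        simp only [Set.mem_inter_iff, Set.mem_preimage]
        rw [hsplit c]
        tauto
      rw [hset]
      exact hQ.markov D F hF (S ∩ R) (T ∩ R) hSR (hT.inter hRm)
    -- the `E`-side: Markov at `E`, (A), (C), (B)
    have hEside : P E (CurveClass.stopAt F ⁻¹' S ∩ CurveClass.startFrom F ⁻¹' T) * P D R =
        ∫⁻ γ in CurveClass.stopAt F ⁻¹' (S ∩ R), Q E (γ.stopAt F) T * Q D (γ.stopAt F) R ∂P D := by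
      -- Markov at `E`, as an integral of an indicator
      have e1 : P E (CurveClass.stopAt F ⁻¹' S ∩ CurveClass.startFrom F ⁻¹' T) =
          ∫⁻ γ, S.indicator (fun p => Q E p T) (γ.stopAt F) ∂P E := by
        rw [hQ.markov E F hF S T hS hT, ← lintegral_indicator (hS.preimage hg)]
        rfl
      -- (A): transfer to `P D` restricted to `R`
      have e2 := stub_restriction_lintegral P hR D E hsub h0 h1
        (fun γ => S.indicator (fun p => Q E p T) (γ.stopAt F)) ((hk.indicator hS).comp hg)
      -- (C): on `R` the past and the future stay in `closure E`
      have e3 : ∫⁻ γ in R, S.indicator (fun p => Q E p T) (γ.stopAt F) ∂P D =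
          ∫⁻ γ in CurveClass.startFrom F ⁻¹' R,
            (S ∩ R).indicator (fun p => Q E p T) (γ.stopAt F) ∂P D := by
        rw [← lintegral_indicator hRm, ← lintegral_indicator (hRm.preimage hf)]
        refine lintegral_congr fun γ => ?_
        by_cases hγ : γ ∈ R
        · have hγ' := (hsplit γ).1 hγ
          rw [Set.indicator_of_mem hγ, Set.indicator_of_mem (show γ ∈ _ from hγ'.2)]
          by_cases hS' : γ.stopAt F ∈ S
          · rw [Set.indicator_of_mem hS', Set.indicator_of_mem (Set.mem_inter hS' hγ'.1)]
          · rw [Set.indicator_of_notMem hS',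
              Set.indicator_of_notMem fun h => hS' (Set.mem_of_mem_inter_left h)]
        · rw [Set.indicator_of_notMem hγ]
          by_cases hfut : γ ∈ CurveClass.startFrom F ⁻¹' R
          · rw [Set.indicator_of_mem hfut, Set.indicator_of_notMem]
            exact fun h => hγ ((hsplit γ).2 ⟨Set.mem_of_mem_inter_right h, hfut⟩)
          · rw [Set.indicator_of_notMem hfut]
      -- (B): Markov at `D` in functional form with `T' = R`
      have e4 := stub_markov_lintegral P Q hQ D F hF R hRm (hQm D R hRm)
        ((S ∩ R).indicator fun p => Q E p T) (hk.indicator hSR)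
      -- back to a set integral
      have e5 : ∫⁻ γ, (S ∩ R).indicator (fun p => Q E p T) (γ.stopAt F) * Q D (γ.stopAt F) R ∂P D =
          ∫⁻ γ in CurveClass.stopAt F ⁻¹' (S ∩ R),
            Q E (γ.stopAt F) T * Q D (γ.stopAt F) R ∂P D := by
        rw [← lintegral_indicator (hSR.preimage hg)]
        refine lintegral_congr fun γ => ?_
        by_cases hγ : γ.stopAt F ∈ S ∩ R
        · rw [Set.indicator_of_mem hγ, Set.indicator_of_mem (show γ ∈ _ from hγ)]
        · rw [Set.indicator_of_notMem hγ, Set.indicator_of_notMem (show γ ∉ _ from hγ),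
            zero_mul]
      rw [e1, e2, e3, e4, e5]
    rw [← hEside, hDside]
  -- from the integrated identity to the a.e. identity, through the image measure of the pasts
  have hφ₁ : Measurable fun p : CurveClass ℂ => Q E p T * Q D p R := hk.mul (hQm D R hRm)
  have hφ₂ : Measurable fun p : CurveClass ℂ => Q D p (T ∩ R) := hQm D (T ∩ R) (hT.inter hRm)
  have hae : ∀ᵐ p ∂((P D).map (CurveClass.stopAt F)).restrict R,
      Q E p T * Q D p R = Q D p (T ∩ R) := by
    refine ae_eq_of_forall_setLIntegral_eq_of_sigmaFinite (μ := ((P D).map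
      (CurveClass.stopAt F)).restrict R) hφ₁ hφ₂ fun S hS _ => ?_
    rw [Measure.restrict_restrict hS, setLIntegral_map (hS.inter hRm) hφ₁ hg,
      setLIntegral_map (hS.inter hRm) hφ₂ hg]
    exact key S hS
  rw [ae_restrict_iff' hRm] at hae
  filter_upwards [ae_of_ae_map hg.aemeasurable hae] with γ hγ
  exact hγ

/-! ### Registered sub-goal of crux stmt-CriticalPhenomena-1370 (line `registered`, stub `stub_relativeRestrictionAE`) -/

/-- **Registered sub-goal `stub_relativeRestrictionAE`** (crux stmt-CriticalPhenomena-1370,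
lead c5): the relative restriction identity `RelRes.relativeRestriction_ae`, notation-free.
[folklore] -/
theorem stub_relativeRestrictionAE : ∀ (P : Literature.Probability.RandomPlanarGeometry.ChordalFamily), P.IsChordal → P.IsRestriction → ∀ (Q : Literature.Probability.RandomPlanarGeometry.DobrushinDomain → Literature.Probability.RandomPlanarGeometry.CurveClass ℂ → MeasureTheory.Measure (Literature.Probability.RandomPlanarGeometry.CurveClass ℂ)), P.IsMarkovExtension Q → (∀ (D : Literature.Probability.RandomPlanarGeometry.DobrushinDomain) (T : Set (Literature.Probability.RandomPlanarGeometry.CurveClass ℂ)), MeasurableSet T → Measurable fun p : Literature.Probability.RandomPlanarGeometry.CurveClass ℂ => Q D p T) → ∀ (D E : Literature.Probability.RandomPlanarGeometry.DobrushinDomain), E.carrier ⊆ D.carrier → E.pt 0 = D.pt 0 → E.pt 1 = D.pt 1 → ∀ (F : Set ℂ), IsClosed F → ∀ (T : Set (Literature.Probability.RandomPlanarGeometry.CurveClass ℂ)), MeasurableSet T → Filter.Eventually (fun γ : Literature.Probability.RandomPlanarGeometry.CurveClass ℂ => γ.stopAt F ∈ Literature.Probability.RandomPlanarGeometry.CurveClass.rangeSubset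 (closure E.carrier) → Q E (γ.stopAt F) T * Q D (γ.stopAt F) (Literature.Probability.RandomPlanarGeometry.CurveClass.rangeSubset (closure E.carrier)) = Q D (γ.stopAt F) (T ∩ Literature.Probability.RandomPlanarGeometry.CurveClass.rangeSubset (closure E.carrier))) (MeasureTheory.ae (P D)) :=
  fun _P hch hR _Q hQ hQm _D _E hsub h0 h1 _F hF _T hT =>
    RelRes.relativeRestriction_ae hch hR hQ hQm hsub h0 h1 hF hT

end Summit.CriticalPhenomena.SAWScalingLimit.Theorems.AxiomsOfLimitKernelClause

end
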